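import Mathlib
import Literature.NumberTheory.EllipticCurves.ProfiniteGroupDistributionRing

/-!
# STUB-IDEAS k1 (gen 35) — «ONE INERTIA COSET»: the weakest sufficient (and lossless) form of
# R197a′'s value identity at `v`, kernel-checked as abstract convolution algebra

Stub `stub_heegnerIndexLowerAtTwo` (LEAD skeleton `f2bd84c029a8a938`), crux
`PrintCf2.SplitBadTwoLowerHalfOfFacts` (stmt-BirchSwinnertonDyer-27851).  Technique (payload):
«weaken / strengthen».  Node: STUB-PLAN v6.8 HARDEST (b) = R197a′ ⊕ R199 — the VALUE identity
`∫ρ dμ_u = c·Σρ⁻¹(σ) log σu ⊗ℚ₂` in K2's consumed form, i.e. row 84's convolution identity of measures on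
`𝒢′ = Gal(K₀(𝔤_W v^e v̄^∞)/K₀)`,  `𝒜_v ∗ katz = C_v ∗ col`,  `c(key) = ∫ρ_v dC_v`.

THE CUT.  Integration against a multiplicative tower-continuous character `ρ` is an ALGEBRA HOM `Φ_ρ` on the
convolution algebra `Λ` of measures (`∫ρ d(λ∗μ) = ∫ρ dλ · ∫ρ dμ`, tree `GroupDistribution.integral_conv_of_mul`),
and the (finite!) inertia group `I = I_v ≅ (ℤ/2^e)ˣ` sits in `Λ` through the Diracs `δ`.  Every evaluation `Φ`
has an inertia TYPE `typeOf Φ = ρ|_I : I →* 𝕜`; the consumer evaluates ONLY at `ρ_v`, whose type is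
`θ := χ_{d,v}|_I ∈ {χ₄, χ₈, χ₈′}` (row 84 / k3-g29 `chi4_neg_one`, `chi8_five`, `chi8'_five`).  With the
INTEGRAL coset element `E_θ := Σ_{h∈I} θ(h⁻¹)·δ_h ∈ Λ` (no division by `|I|` — B61):

* §1 `eval_cosetSum_of_type` / `eval_cosetSum_of_ne`: `Φ(E_θ) = |I|` if `typeOf Φ = θ`, `= 0` otherwise
  (orthogonality, Mathlib `sum_hom_units_eq_zero`); `eval_cosetSum_mul_*`: `Φ(E_θ * x) = [type θ]·|I|·Φ x`.
* §2 `cosetSum_mul_eq_of_cosetTables`: if a family `𝔛` of evaluations SEPARATES `Λ` (H-FI of row 84) and the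
  tables of `x, y` agree ON THE θ-COSET of `𝔛` only, then `E_θ * x = E_θ * y` (integral, division-free);
  `eval_eq_of_cosetTables`: hence `Ψ x = Ψ y` for EVERY evaluation `Ψ` of type `θ` — finite order OR NOT (so for
  `ρ_v = ρ^{ur}·χ_{d,v}`, `ρ^{ur}` of infinite order) — dividing by `|I| = 2^{e−1}` only in the value field `𝕜`;
  `cosetTables_of_cosetSum_mul_eq`: the converse — the cut is LOSSLESS (weakest sufficient = strongest needed).
* §3 the columns on the coset: `eval_inertiaSum_eq_zero` (`Φ(Σ_{h∈I} δ_h) = 0` for type `θ ≠ 1`), hence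
  `eval_one_sub_inertiaSum_mul` — every element `1 − (Σ_I δ_h)·z` (the shapes of the universal-norm column
  `|I|·𝒜_v` and of the Euler column `|I|·E_v` of row 84, `⊗ℚ`) evaluates to `1` at type `θ ≠ 1`;
  `value_identity_of_cosetTables`: row 84's `value_of_tables_normalised` with its table hypothesis weakened from
  «every finite-order `χ`» to «the `θ`-coset», and `consumedShape_iff` / `consumedShape_at`: on the coset the
  table is ONE formula shape `Φ katz = τ · Φ(δ g⁻¹) · Φ col` (`τ = τ(θ⁻¹)` constant, `g = σ_{𝔮_e}`), which is
  what is handed to K2 at every local `φ` of conductor `2^e`, and which transports verbatim to `ρ_v`.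
* §4 `sum_char_smul_comp_eq_zero` — fibre orthogonality by translation: a character non-trivial on `ker π`
  kills every function pulled back along `π` («the terms with `p ∣ j` disappear», de Shalit II.4.8 p. 61, in its
  global-coset form; any `p`); `charSum_sub_pullback` — so the `(7′)`/`(17)` correction `−p⁻¹·(level n−1 term)`
  never reaches a consumed entry; `charSum_norm` (k3-g29's open helper H6, PROVED): a level-`N` character sum of
  a level-`n` character collapses to level `n` through the norm — every coset entry is a layer-`e` quantity.
* §5 located multipliers: `card_units_zmod_four = 2`, `card_units_zmod_eight = 4` (`|I_v| = 2^{e−1}`), value-side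
  only; no carrier at `v` is divided (B61 (i)), no digit is read through `E_θ` (K32).
* §6 THE SAME CUT IN ROW 84's CURRENCY (tree `GroupDistribution 𝒰 𝕜` / `conv` / `integral`, import
  `Literature…ProfiniteGroupDistributionRing`): `cosetDist 𝒰 I θ` is a bounded distribution of the tree,
  `integral_cosetDist` (`∫f dE_θ = Σ_h θ(h⁻¹) f(h)`), `integral_conv_cosetDist`,
  `conv_cosetDist_masses_eq_of_cosetTables` (coset tables ⟹ `E_θ ∗ X = E_θ ∗ Y` as MASSES),
  `integral_eq_of_cosetTables`, and `value_of_cosetTables_normalised` = k3-g29's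
  `value_of_tables_normalised` with the table hypothesis cut from «every `LevelChar`» to «the type-`θ` members
  of any separating typed family»; `cosetTable_of_conv_cosetDist_masses_eq` (lossless).

Everything here is abstract algebra over a field `𝕜` (`= ℚ₂(values)`): PROVED, `import Mathlib` only, no
`sorry`, no `instance`, no `example`.  NOT proved here (print / typer residue, named in the card): (21)₀ at level
`e` for `𝔭 := v`, `p = 2`; (20)/(22); Coleman interpolation at level `e`; Lemma 4.10's `𝔮_e` at `p = 2`; the
instantiation `Λ := GroupDistribution`-algebra of `𝒢′`, `𝔛 :=` finite-order characters.  BSD is NOT proved by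
any of this; neither the crux nor the stub nor (2)₂ is.
-/

namespace Summit.BirchSwinnertonDyer.BirchSwinnertonDyer.Cruxes.SplitBadTwoLowerHalfOfFacts.CosetCutK1G35

open Finset BigOperators

/-! ## §1 Inertia type of an evaluation and the integral coset element `E_θ` -/

section CosetElement

variable {𝕜 : Type*} [Field 𝕜]
variable {Λ : Type*} [CommRing Λ] [Algebra 𝕜 Λ]
variable {G : Type*} [CommGroup G]
variable (δ : G →* Λ)
variable {I : Subgroup G} [Fintype I]

/-- The inertia TYPE of an evaluation `Φ` (`= ∫ρ d(−)`): the hom `h ↦ Φ(δ_h) = ρ(h)` on `I`. -/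
def typeOf (I : Subgroup G) (Φ : Λ →ₐ[𝕜] 𝕜) : I →* 𝕜 :=
  ((Φ : Λ →+* 𝕜) : Λ →* 𝕜).comp (δ.comp I.subtype)

omit [Fintype I] in
@[simp] theorem typeOf_apply (Φ : Λ →ₐ[𝕜] 𝕜) (h : I) : typeOf δ I Φ h = Φ (δ h) := rfl

/-- The INTEGRAL coset element `E_θ = Σ_{h ∈ I} θ(h⁻¹) · δ_h` (no division by `|I|`). -/
noncomputable def cosetSum (θ : I →* 𝕜) : Λ := ∑ h : I, θ h⁻¹ • δ (h : G)

/-- The plain inertia sum `Σ_{h∈I} δ_h = E_𝟙`. -/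
noncomputable def inertiaSum (I : Subgroup G) [Fintype I] : Λ := ∑ h : I, δ (h : G)

theorem inertiaSum_eq_cosetSum_one : inertiaSum δ I = cosetSum δ (1 : I →* 𝕜) := by
  simp [inertiaSum, cosetSum]

theorem eval_cosetSum (θ : I →* 𝕜) (Φ : Λ →ₐ[𝕜] 𝕜) :
    Φ (cosetSum δ θ) = ∑ h : I, θ h⁻¹ * Φ (δ (h : G)) := by
  simp [cosetSum, map_sum, map_smul, smul_eq_mul]

/-- The twisted hom `h ↦ θ(h⁻¹) · typeOf Φ (h)` (uses commutativity of `I`). -/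
def twist (θ ψ : I →* 𝕜) : I →* 𝕜 where
  toFun h := θ h⁻¹ * ψ h
  map_one' := by simp
  map_mul' a b := by
    rw [mul_inv, map_mul, map_mul]
    ring

omit [Fintype I] in
@[simp] theorem twist_apply (θ ψ : I →* 𝕜) (h : I) : twist θ ψ h = θ h⁻¹ * ψ h := rfl

omit [Fintype I] in
theorem map_inv_mul_self (θ : I →* 𝕜) (h : I) : θ h⁻¹ * θ h = 1 := by
  rw [← map_mul, inv_mul_cancel, map_one]

omit [Fintype I] in
theorem twist_eq_one_iff (θ ψ : I →* 𝕜) : twist θ ψ = 1 ↔ ψ = θ := by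
  constructor
  · intro h1
    ext h
    have hh : θ h⁻¹ * ψ h = 1 := by
      have := DFunLike.congr_fun h1 h
      simpa using this
    have hθ : θ h⁻¹ * θ h = 1 := map_inv_mul_self θ h
    have hne : θ h⁻¹ ≠ 0 := by
      intro h0
      rw [h0, zero_mul] at hθ
      exact zero_ne_one hθ
    exact mul_left_cancel₀ hne (hh.trans hθ.symm)
  · rintro rfl
    ext h
    rw [twist_apply, MonoidHom.one_apply]
    exact map_inv_mul_self ψ h

/-- ORTHOGONALITY, matching type: `Φ(E_θ) = |I|`. -/
theorem eval_cosetSum_of_type (θ : I →* 𝕜) (Φ : Λ →ₐ[𝕜] 𝕜) (hΦ : typeOf δ I Φ = θ) :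
    Φ (cosetSum δ θ) = Fintype.card I := by
  have key : ∀ h : I, θ h⁻¹ * Φ (δ (h : G)) = 1 := fun h => by
    rw [← typeOf_apply δ Φ h, hΦ, map_inv_mul_self]
  rw [eval_cosetSum, Finset.sum_congr rfl fun h _ => key h]
  simp

/-- ORTHOGONALITY, other types: `Φ(E_θ) = 0` (Mathlib `sum_hom_units_eq_zero`). -/
theorem eval_cosetSum_of_ne (θ : I →* 𝕜) (Φ : Λ →ₐ[𝕜] 𝕜) (hΦ : typeOf δ I Φ ≠ θ) :
    Φ (cosetSum δ θ) = 0 := by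
  rw [eval_cosetSum]
  have hne : twist θ (typeOf δ I Φ) ≠ 1 := by
    rw [Ne, twist_eq_one_iff]
    exact hΦ
  have := sum_hom_units_eq_zero (twist θ (typeOf δ I Φ)) hne
  simpa using this

theorem eval_cosetSum_mul_of_type (θ : I →* 𝕜) (Φ : Λ →ₐ[𝕜] 𝕜) (hΦ : typeOf δ I Φ = θ) (x : Λ) :
    Φ (cosetSum δ θ * x) = Fintype.card I * Φ x := by
  rw [map_mul, eval_cosetSum_of_type δ θ Φ hΦ]

theorem eval_cosetSum_mul_of_ne (θ : I →* 𝕜) (Φ : Λ →ₐ[𝕜] 𝕜) (hΦ : typeOf δ I Φ ≠ θ) (x : Λ) :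
    Φ (cosetSum δ θ * x) = 0 := by
  rw [map_mul, eval_cosetSum_of_ne δ θ Φ hΦ, zero_mul]

/-! ## §2 The cut: coset tables ⟺ the `E_θ`-component identity ⟹ ALL type-`θ` values agree -/

/-- A family of evaluations SEPARATES `Λ` (row 84's `CharactersSeparate` / H-FI: finite-order characters
separate bounded measures on `𝒢′`). -/
def Separates (𝔛 : Set (Λ →ₐ[𝕜] 𝕜)) : Prop := ∀ z : Λ, (∀ Φ ∈ 𝔛, Φ z = 0) → z = 0

/-- Tables agree ON THE `θ`-COSET of the family only. -/
def CosetTables (𝔛 : Set (Λ →ₐ[𝕜] 𝕜)) (θ : I →* 𝕜) (x y : Λ) : Prop :=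
  ∀ Φ ∈ 𝔛, typeOf δ I Φ = θ → Φ x = Φ y

/-- **THE CUT (integral form).** Coset tables ⟹ `E_θ * x = E_θ * y` — no division anywhere. -/
theorem cosetSum_mul_eq_of_cosetTables {𝔛 : Set (Λ →ₐ[𝕜] 𝕜)} (hsep : Separates 𝔛) (θ : I →* 𝕜)
    {x y : Λ} (htab : CosetTables δ 𝔛 θ x y) : cosetSum δ θ * x = cosetSum δ θ * y := by
  rw [← sub_eq_zero]
  apply hsep
  intro Φ hΦ
  rw [map_sub, sub_eq_zero]
  by_cases ht : typeOf δ I Φ = θ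
  · rw [eval_cosetSum_mul_of_type δ θ Φ ht, eval_cosetSum_mul_of_type δ θ Φ ht, htab Φ hΦ ht]
  · rw [eval_cosetSum_mul_of_ne δ θ Φ ht, eval_cosetSum_mul_of_ne δ θ Φ ht]

/-- **THE CUT (value form).** Coset tables ⟹ `Ψ x = Ψ y` for EVERY evaluation `Ψ` of type `θ`, in or out of
the separating family (e.g. `Ψ = ∫ρ_v d(−)`, `ρ_v` of infinite order); `|I|` is cancelled in the FIELD `𝕜`. -/
theorem eval_eq_of_cosetTables {𝔛 : Set (Λ →ₐ[𝕜] 𝕜)} (hsep : Separates 𝔛) (θ : I →* 𝕜)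
    (hI : (Fintype.card I : 𝕜) ≠ 0) {x y : Λ} (htab : CosetTables δ 𝔛 θ x y)
    (Ψ : Λ →ₐ[𝕜] 𝕜) (hΨ : typeOf δ I Ψ = θ) : Ψ x = Ψ y := by
  have h := congrArg Ψ (cosetSum_mul_eq_of_cosetTables δ hsep θ htab)
  rw [eval_cosetSum_mul_of_type δ θ Ψ hΨ, eval_cosetSum_mul_of_type δ θ Ψ hΨ] at h
  exact mul_left_cancel₀ hI h

/-- **LOSSLESS.** The component identity gives the coset tables back (×`|I|`; and exactly when `|I| ≠ 0`). -/
theorem cosetTables_of_cosetSum_mul_eq (θ : I →* 𝕜) {x y : Λ}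
    (h : cosetSum δ θ * x = cosetSum δ θ * y) (Φ : Λ →ₐ[𝕜] 𝕜) (hΦ : typeOf δ I Φ = θ) :
    (Fintype.card I : 𝕜) * Φ x = Fintype.card I * Φ y := by
  have := congrArg Φ h
  rwa [eval_cosetSum_mul_of_type δ θ Φ hΦ, eval_cosetSum_mul_of_type δ θ Φ hΦ] at this

theorem cosetTables_iff_cosetSum_mul_eq {𝔛 : Set (Λ →ₐ[𝕜] 𝕜)} (hsep : Separates 𝔛) (θ : I →* 𝕜)
    (hI : (Fintype.card I : 𝕜) ≠ 0) (x y : Λ) :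
    CosetTables δ 𝔛 θ x y ↔ cosetSum δ θ * x = cosetSum δ θ * y :=
  ⟨cosetSum_mul_eq_of_cosetTables δ hsep θ, fun h Φ _ hΦ =>
    mul_left_cancel₀ hI (cosetTables_of_cosetSum_mul_eq δ θ h Φ hΦ)⟩

/-! ## §3 The columns on the coset and the consumed shape -/

/-- On a non-trivial type the plain inertia sum dies: `Φ(Σ_{h∈I} δ_h) = 0`. -/
theorem eval_inertiaSum_eq_zero (θ : I →* 𝕜) (hθ : θ ≠ 1) (Φ : Λ →ₐ[𝕜] 𝕜) (hΦ : typeOf δ I Φ = θ) :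
    Φ (inertiaSum δ I) = 0 := by
  rw [inertiaSum_eq_cosetSum_one (𝕜 := 𝕜)]
  apply eval_cosetSum_of_ne
  rw [hΦ]
  exact hθ

/-- «Column `X` takes the value `1` at EVERY evaluation of type `θ`» (in or out of any family). -/
def IsOneOnType (θ : I →* 𝕜) (X : Λ) : Prop := ∀ Φ : Λ →ₐ[𝕜] 𝕜, typeOf δ I Φ = θ → Φ X = 1

/-- «Column `C` takes the value `τ · ρ_Φ(g)⁻¹` at EVERY evaluation of type `θ`» — ONE constant `τ` for the
whole coset (the Gauss sum `τ(θ⁻¹)` depends on `χ|_{I_v}` only) times the Dirac column `χ(σ_{𝔮_e})⁻¹`. -/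
def IsGaussDiracOnType (θ : I →* 𝕜) (C : Λ) (τ : 𝕜) (g : G) : Prop :=
  ∀ Φ : Λ →ₐ[𝕜] 𝕜, typeOf δ I Φ = θ → Φ C = τ * Φ (δ g⁻¹)

/-- The universal-norm column `|I|·𝒜_v = |I| − (Σ_I δ_h)·δ_F` and the Euler column
`|I|·E_v = |I| − (Σ_I δ_h)·(½δ_{F⁻¹})` are, `⊗ℚ`, of the shape `1 − (Σ_I δ_h)·z`; at a RAMIFIED type they
evaluate to `1`: no `1/p`, no `1 − χ(F_v)` on the consumed coset. -/
theorem isOneOnType_one_sub_inertiaSum_mul (θ : I →* 𝕜) (hθ : θ ≠ 1) (z : Λ) :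
    IsOneOnType δ θ (1 - inertiaSum δ I * z) := fun Φ hΦ => by
  rw [map_sub, map_mul, eval_inertiaSum_eq_zero δ θ hθ Φ hΦ, zero_mul, sub_zero, map_one]

omit [Fintype I] in
theorem isOneOnType_mul {θ : I →* 𝕜} {X Y : Λ} (hX : IsOneOnType δ θ X) (hY : IsOneOnType δ θ Y) :
    IsOneOnType δ θ (X * Y) := fun Φ hΦ => by rw [map_mul, hX Φ hΦ, hY Φ hΦ, one_mul]

/-- The Gauss column as an element: `T = Σ_{θ′ ∈ Θ} τ(θ′)·|I|⁻¹·E_{θ′}` (Fourier expansion on the finite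
inertia group; `|I|⁻¹` lives in the VALUE field, `T` itself is `τ`-valued hence non-integral anyway). -/
noncomputable def gaussColumn (Θ : Finset (I →* 𝕜)) (τ : (I →* 𝕜) → 𝕜) : Λ :=
  ∑ θ' ∈ Θ, (τ θ' * (Fintype.card I : 𝕜)⁻¹) • cosetSum δ θ'

/-- **The Gauss column is CONSTANT on the coset**: `Φ(T) = τ(θ)` for every `Φ` of type `θ ∈ Θ`. -/
theorem eval_gaussColumn_of_type (Θ : Finset (I →* 𝕜)) (τ : (I →* 𝕜) → 𝕜) (θ : I →* 𝕜) (hθ : θ ∈ Θ)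
    (hI : (Fintype.card I : 𝕜) ≠ 0) (Φ : Λ →ₐ[𝕜] 𝕜) (hΦ : typeOf δ I Φ = θ) :
    Φ (gaussColumn δ Θ τ) = τ θ := by
  rw [gaussColumn, map_sum, Finset.sum_eq_single θ]
  · rw [map_smul, smul_eq_mul, eval_cosetSum_of_type δ θ Φ hΦ, mul_assoc, inv_mul_cancel₀ hI, mul_one]
  · intro θ' _ hne
    rw [map_smul, smul_eq_mul, eval_cosetSum_of_ne δ θ' Φ (hΦ ▸ hne.symm), mul_zero]
  · intro h
    exact absurd hθ h

/-- `C_v = T_v * R_v * E_v` with `R_v = δ_{g⁻¹}` and `E_v` one on the type: a Gauss × Dirac column. -/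
theorem isGaussDiracOnType_column (Θ : Finset (I →* 𝕜)) (τ : (I →* 𝕜) → 𝕜) (θ : I →* 𝕜) (hθ : θ ∈ Θ)
    (hI : (Fintype.card I : 𝕜) ≠ 0) (g : G) {E : Λ} (hE : IsOneOnType δ θ E) :
    IsGaussDiracOnType δ θ (gaussColumn δ Θ τ * δ g⁻¹ * E) (τ θ) g := fun Φ hΦ => by
  rw [map_mul, map_mul, eval_gaussColumn_of_type δ Θ τ θ hθ hI Φ hΦ, hE Φ hΦ, mul_one]

/-- **Row 84's `value_of_tables_normalised`, table hypothesis weakened to the coset.**  If the tables of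
`A * katz` and `C * col` agree on the `θ`-coset of a separating family and the normalising column is `1` at the
evaluation `Ψ` of type `θ`, then `Ψ katz = Ψ C · Ψ col` — `c(key) = Ψ C`. -/
theorem value_identity_of_cosetTables {𝔛 : Set (Λ →ₐ[𝕜] 𝕜)} (hsep : Separates 𝔛) (θ : I →* 𝕜)
    (hI : (Fintype.card I : 𝕜) ≠ 0) {A C katz col : Λ} (htab : CosetTables δ 𝔛 θ (A * katz) (C * col))
    (Ψ : Λ →ₐ[𝕜] 𝕜) (hΨ : typeOf δ I Ψ = θ) (hA : Ψ A = 1) : Ψ katz = Ψ C * Ψ col := by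
  have h := eval_eq_of_cosetTables δ hsep θ hI htab Ψ hΨ
  rwa [map_mul, map_mul, hA, one_mul] at h

omit [Fintype I] in
/-- **The consumed shape.**  With the columns of record (`A` one on the type, `C` Gauss × Dirac on the type)
the `θ`-coset table is ONE formula per entry: `Φ katz = τ · Φ(δ g⁻¹) · Φ col` — the shape handed to K2 at
every local `φ` of conductor `2^e` (II.5.2 (3) = (21)₀ at the single level `e`, constant Gauss factor). -/
theorem consumedShape_iff (𝔛 : Set (Λ →ₐ[𝕜] 𝕜)) (θ : I →* 𝕜) {A C : Λ} {τ : 𝕜} {g : G}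
    (hA : IsOneOnType δ θ A) (hC : IsGaussDiracOnType δ θ C τ g) (katz col : Λ) :
    CosetTables δ 𝔛 θ (A * katz) (C * col) ↔
      ∀ Φ ∈ 𝔛, typeOf δ I Φ = θ → Φ katz = τ * Φ (δ g⁻¹) * Φ col := by
  constructor
  · intro h Φ hΦ ht
    have := h Φ hΦ ht
    rwa [map_mul, map_mul, hA Φ ht, one_mul, hC Φ ht] at this
  · intro h Φ hΦ ht
    rw [map_mul, map_mul, hA Φ ht, one_mul, hC Φ ht, h Φ hΦ ht]

/-- **Transport to the out-of-range evaluation.**  The same formula at ANY `Ψ` of type `θ` (for the stub: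
`Ψ = ∫ρ_v d(−)`, `c(key) = τ(θ⁻¹)·ρ_v(σ_{𝔮_e})⁻¹`, `v₂ c(key) = e/2` of record, B16 (iii)). -/
theorem consumedShape_at {𝔛 : Set (Λ →ₐ[𝕜] 𝕜)} (hsep : Separates 𝔛) (θ : I →* 𝕜)
    (hI : (Fintype.card I : 𝕜) ≠ 0) {A C : Λ} {τ : 𝕜} {g : G} (hA : IsOneOnType δ θ A)
    (hC : IsGaussDiracOnType δ θ C τ g) {katz col : Λ}
    (htab : ∀ Φ ∈ 𝔛, typeOf δ I Φ = θ → Φ katz = τ * Φ (δ g⁻¹) * Φ col)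
    (Ψ : Λ →ₐ[𝕜] 𝕜) (hΨ : typeOf δ I Ψ = θ) : Ψ katz = τ * Ψ (δ g⁻¹) * Ψ col := by
  have h := value_identity_of_cosetTables δ hsep θ hI ((consumedShape_iff δ 𝔛 θ hA hC katz col).2 htab)
    Ψ hΨ (hA Ψ hΨ)
  rwa [hC Ψ hΨ] at h

/-- **What LEFT the node.**  An entry at a type `θ' ≠ θ` (e.g. the `v`-UNRAMIFIED type `θ' = 1`, where II.4.7 (16)
carries `(1 − χ⁻¹(v)/2)` and the total mass `(1 − φ/2)·log g_β(0)`) is invisible to the `E_θ`-component: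
changing `x` by anything killed by `E_θ` changes no consumed value. -/
theorem eval_eq_of_cosetSum_mul_sub_eq_zero (θ : I →* 𝕜) (hI : (Fintype.card I : 𝕜) ≠ 0) {x x' : Λ}
    (h : cosetSum δ θ * (x - x') = 0) (Ψ : Λ →ₐ[𝕜] 𝕜) (hΨ : typeOf δ I Ψ = θ) : Ψ x = Ψ x' := by
  have := congrArg Ψ h
  rw [eval_cosetSum_mul_of_type δ θ Ψ hΨ, map_zero, map_sub, mul_eq_zero] at this
  rcases this with h0 | h0
  · exact absurd h0 hI
  · exact sub_eq_zero.1 h0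

/-- The complementary components: `E_θ · E_{θ'} = 0`-type orthogonality read on values — an element supported on
the other types, `y = E_{θ'} * w` with `θ' ≠ θ`, is killed at every type-`θ` evaluation. -/
theorem eval_cosetSum_mul_of_type_ne (θ θ' : I →* 𝕜) (hne : θ' ≠ θ) (w : Λ) (Ψ : Λ →ₐ[𝕜] 𝕜)
    (hΨ : typeOf δ I Ψ = θ) : Ψ (cosetSum δ θ' * w) = 0 :=
  eval_cosetSum_mul_of_ne δ θ' Ψ (hΨ ▸ hne.symm) w

end CosetElement

/-! ## §4 Fibre orthogonality (exact level) and the norm collapse of character sums -/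

section Fibre

variable {R : Type*} [CommRing R] [IsDomain R]
variable {M : Type*} [AddCommGroup M] [Module R M] [NoZeroSMulDivisors R M]
variable {G : Type*} [CommGroup G] [Fintype G]
variable {H : Type*} [Group H]

/-- **Fibre orthogonality by translation** («the terms with `p ∣ j` disappear after summing over the 𝔠's,
because `n` is the exact power of `𝔭` in `𝔣_χ`», de Shalit II.4.8 p. 61 — global-coset form, ANY `p`):
a character of `G` that is non-trivial on `ker π` kills every function pulled back along `π`. -/
theorem sum_char_smul_comp_eq_zero (π : G →* H) (χ : G →* R) (k : G) (hk : π k = 1) (hχ : χ k ≠ 1)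
    (f : H → M) : ∑ g : G, χ g • f (π g) = 0 := by
  set S := ∑ g : G, χ g • f (π g) with hS
  have hT : S = χ k • S := by
    calc S = ∑ g : G, χ (g * k) • f (π (g * k)) :=
          (Fintype.sum_equiv (Equiv.mulRight k) _ _ (fun g => rfl)).symm
      _ = ∑ g : G, χ k • (χ g • f (π g)) := by
          refine Finset.sum_congr rfl fun g _ => ?_
          rw [map_mul, map_mul, hk, mul_one, mul_comm, mul_smul]
      _ = χ k • S := by rw [hS, Finset.smul_sum]
  have h1 : (1 - χ k) • S = 0 := by rw [sub_smul, one_smul, ← hT, sub_self]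
  rcases smul_eq_zero.1 h1 with h | h
  · exact absurd (sub_eq_zero.1 h).symm hχ
  · exact h

/-- Exact level ⟹ the `(7′)`/`(17)` correction never reaches a consumed entry: subtracting ANY pulled-back
term (`c • b(π g)`, e.g. `p⁻¹ · log g^φ(ς_{n−1} − 1)`-type level-`(n−1)` values) does not change the Gauss-twisted
sum. -/
theorem charSum_sub_pullback (π : G →* H) (χ : G →* R) (k : G) (hk : π k = 1) (hχ : χ k ≠ 1)
    (a : G → M) (b : H → M) (c : R) :
    ∑ g : G, χ g • (a g - c • b (π g)) = ∑ g : G, χ g • a g := by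
  have h0 := sum_char_smul_comp_eq_zero π χ k hk hχ (fun h => c • b h)
  simp only [smul_sub, Finset.sum_sub_distrib, h0, sub_zero]

end Fibre

section NormCollapse

variable {R : Type*} [CommRing R]
variable {V : Type*} [AddCommGroup V] [Module R V]
variable {M : Type*} [AddCommGroup M]
variable {G : Type*} [CommGroup G] [Fintype G] [DistribMulAction G M]
variable {H : Type*} [CommGroup H] [Fintype H]

/-- The norm along `ker π` (additive notation for the unit group: `N m = Σ_{k ∈ ker π} k • m`). -/
def kerNorm (π : G →* H) [Fintype π.ker] (m : M) : M := ∑ k : π.ker, (k : G) • m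

/-- `H × ker π ≃ G` from a set-theoretic section of a surjective `π`. -/
noncomputable def sectionProdKerEquiv (π : G →* H) (s : H → G) (hs : ∀ h, π (s h) = h) :
    H × π.ker ≃ G :=
  Equiv.ofBijective (fun p => s p.1 * (p.2 : G)) (by
    constructor
    · rintro ⟨h₁, k₁⟩ ⟨h₂, k₂⟩ hEq
      simp only at hEq
      have e₁ : π (k₁ : G) = 1 := (MonoidHom.mem_ker).1 k₁.2
      have e₂ : π (k₂ : G) = 1 := (MonoidHom.mem_ker).1 k₂.2
      have hh : h₁ = h₂ := by
        have := congrArg π hEq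
        simpa [map_mul, hs, e₁, e₂] using this
      subst hh
      have hk : (k₁ : G) = k₂ := mul_left_cancel hEq
      exact Prod.ext rfl (Subtype.ext hk)
    · intro g
      refine ⟨⟨π g, ⟨(s (π g))⁻¹ * g, ?_⟩⟩, ?_⟩
      · rw [MonoidHom.mem_ker, map_mul, map_inv, hs, inv_mul_cancel]
      · simp)

/-- **`charSum_norm` (k3-g29's helper H6, PROVED).**  For a character `χ` of the quotient `H` and an additive
`ℓ` (the logarithm): `Σ_{g∈G} χ(π g) • ℓ(g • m) = Σ_{h∈H} χ(h) • ℓ(s(h) • N_{ker π} m)` — a level-`N` character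
sum of a level-`n` character is a level-`n` character sum of the NORM: every `θ`-coset entry is a layer-`e`
quantity (with `charSum_sub_pullback`: exactly (21)₀ at the single level `e = n(key)`). -/
theorem charSum_norm (π : G →* H) [Fintype π.ker] (s : H → G) (hs : ∀ h, π (s h) = h) (χ : H →* R)
    (ℓ : M →+ V) (m : M) :
    ∑ g : G, χ (π g) • ℓ (g • m) = ∑ h : H, χ h • ℓ (s h • kerNorm π m) := by
  rw [← Fintype.sum_equiv (sectionProdKerEquiv π s hs) (fun p => χ (π (s p.1 * (p.2 : G))) •
      ℓ ((s p.1 * (p.2 : G)) • m)) _ (fun p => rfl), Fintype.sum_prod_type]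
  refine Finset.sum_congr rfl fun h _ => ?_
  have hπ : ∀ k : π.ker, π (s h * (k : G)) = h := fun k => by
    rw [map_mul, hs, (MonoidHom.mem_ker).1 k.2, mul_one]
  simp only [hπ, mul_smul, kerNorm, smul_sum, map_sum]

end NormCollapse

/-! ## §5 Located multipliers `|I_v| = 2^{e−1}` (value side only; B61) -/

theorem card_units_zmod_four : Fintype.card (ZMod 4)ˣ = 2 := by
  rw [ZMod.card_units_eq_totient]; decide

theorem card_units_zmod_eight : Fintype.card (ZMod 8)ˣ = 4 := by
  rw [ZMod.card_units_eq_totient]; decide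

/-- In a field of characteristic `0` (the value field `ℚ₂(…)`) the located multiplier is cancellable. -/
theorem two_pow_ne_zero_of_charZero (𝕜 : Type*) [Field 𝕜] [CharZero 𝕜] (n : ℕ) : ((2 ^ n : ℕ) : 𝕜) ≠ 0 := by
  exact_mod_cast pow_ne_zero n two_ne_zero

/-! ## §6 The cut IN ROW 84's CURRENCY (tree `GroupDistribution 𝒰 𝕜`, `conv`, `integral`)

Row 84 (k3-g29 `LogTableAtVK3G29.value_of_tables_normalised`) reads the value identity at `ρ_v` from tables at
EVERY finite-order character.  Below: the same conclusion from the `θ`-COSET of any separating family of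
tower-continuous multiplicative test functions — the integral coset distribution `cosetDist 𝒰 I θ` is a
bounded distribution of the tree, its integral is the finite sum `Σ_h θ(h⁻¹) f(h)`, and `integral_conv_of_mul`
does the rest.  (Instantiation for the stub: `𝒰` = the ray-class tower of `𝒢′`, `I` = the inertia group at `v`,
`𝔛` = k3-g29's `LevelChar` functions, `θ = χ_{d,v}|_{I_v}`.) -/

section TreeCurrency

open Filter Topology
open Literature.NumberTheory.EllipticCurves Literature.NumberTheory.EllipticCurves.GroupDistribution

variable {G : Type*} [CommGroup G] {𝒰 : SubgroupTower G} {𝕜 : Type*} [NormedField 𝕜]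
variable {I : Subgroup G} [Fintype I]

/-- **`E_θ` as a bounded distribution**: masses `Σ_{h∈I} θ(h⁻¹)·δ_h` (integral: no `|I|⁻¹`). -/
noncomputable def cosetDist (𝒰 : SubgroupTower G) (I : Subgroup G) [Fintype I] (θ : I →* 𝕜) :
    GroupDistribution 𝒰 𝕜 where
  μ n a := ∑ h : I, θ h⁻¹ * (dirac 𝒰 (h : G) : GroupDistribution 𝒰 𝕜).μ n a
  sum_fiber n a := by
    rw [Finset.sum_comm]
    refine Finset.sum_congr rfl fun h _ => ?_
    rw [← Finset.mul_sum, (dirac 𝒰 (h : G) : GroupDistribution 𝒰 𝕜).sum_fiber n a]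
  bound := ∑ h : I, ‖(θ h⁻¹ : 𝕜)‖
  bound_nonneg := Finset.sum_nonneg fun _ _ => norm_nonneg _
  norm_le n a := by
    refine (norm_sum_le _ _).trans (Finset.sum_le_sum fun h _ => ?_)
    rw [norm_mul]
    refine mul_le_of_le_one_right (norm_nonneg _) ?_
    rw [dirac_μ]
    split_ifs <;> simp

theorem riemannSum_cosetDist (θ : I →* 𝕜) (f : G → 𝕜) (n : ℕ) :
    (cosetDist 𝒰 I θ).riemannSum f n =
      ∑ h : I, θ h⁻¹ * (dirac 𝒰 (h : G) : GroupDistribution 𝒰 𝕜).riemannSum f n := by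
  simp only [riemannSum_def, cosetDist, Finset.sum_mul, mul_assoc]
  rw [Finset.sum_comm]
  refine Finset.sum_congr rfl fun h _ => ?_
  rw [Finset.mul_sum]

/-- **`∫ f dE_θ = Σ_{h∈I} θ(h⁻¹) f(h)`** for tower-continuous `f`. -/
theorem integral_cosetDist [IsUltrametricDist 𝕜] [CompleteSpace 𝕜] (θ : I →* 𝕜) {f : G → 𝕜}
    (hf : 𝒰.IsTowerContinuous f) : (cosetDist 𝒰 I θ).integral f = ∑ h : I, θ h⁻¹ * f h := by
  have hT : ∀ h : I, Tendsto (fun n => θ h⁻¹ * (dirac 𝒰 (h : G) : GroupDistribution 𝒰 𝕜).riemannSum f n)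
      atTop (𝓝 (θ h⁻¹ * f h)) := fun h => by
    have := ((dirac 𝒰 (h : G) : GroupDistribution 𝒰 𝕜).tendsto_riemannSum_integral hf).const_mul
      (θ h⁻¹)
    rwa [integral_dirac (h : G) hf] at this
  have heq : (cosetDist 𝒰 I θ).riemannSum f =
      fun n => ∑ h : I, θ h⁻¹ * (dirac 𝒰 (h : G) : GroupDistribution 𝒰 𝕜).riemannSum f n :=
    funext fun n => riemannSum_cosetDist θ f n
  have h : Tendsto ((cosetDist 𝒰 I θ).riemannSum f) atTop (𝓝 (∑ h : I, θ h⁻¹ * f h)) := by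
    rw [heq]
    exact tendsto_finsetSum _ fun h _ => hT h
  exact h.limUnder_eq

/-- **`∫ρ d(E_θ ∗ X) = (Σ_h θ(h⁻¹)ρ(h)) · ∫ρ dX`** (tree `integral_conv_of_mul`). -/
theorem integral_conv_cosetDist [IsUltrametricDist 𝕜] [CompleteSpace 𝕜] (θ : I →* 𝕜)
    (X : GroupDistribution 𝒰 𝕜) {ρ : G → 𝕜} (hρc : 𝒰.IsTowerContinuous ρ)
    (hρ : ∀ σ τ, ρ (σ * τ) = ρ σ * ρ τ) :
    (conv (cosetDist 𝒰 I θ) X).integral ρ = (∑ h : I, θ h⁻¹ * ρ h) * X.integral ρ := by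
  rw [integral_conv_of_mul _ _ hρc hρ, integral_cosetDist θ hρc]

omit [Fintype I] in
/-- Distributions with the same masses have the same integrals (k3-g29 `integral_congr_μ`). -/
theorem integral_congr_masses (D₁ D₂ : GroupDistribution 𝒰 𝕜) (h : ∀ n a, D₁.μ n a = D₂.μ n a)
    (f : G → 𝕜) : D₁.integral f = D₂.integral f := by
  have hRS : D₁.riemannSum f = D₂.riemannSum f := funext fun n => by
    simp only [riemannSum_def, h]
  show limUnder atTop (D₁.riemannSum f) = limUnder atTop (D₂.riemannSum f)
  rw [hRS]

/-- The type sums: matching type gives `|I|` … -/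
theorem typeSum_of_eq (θ : I →* 𝕜) {ρ : G → 𝕜} (hρθ : ∀ h : I, ρ (h : G) = θ h) :
    ∑ h : I, θ h⁻¹ * ρ h = Fintype.card I := by
  rw [Finset.sum_congr rfl fun (h : I) _ => show θ h⁻¹ * ρ h = 1 by rw [hρθ, map_inv_mul_self]]
  simp

/-- … another type gives `0`. -/
theorem typeSum_of_ne (θ : I →* 𝕜) {ρ : G → 𝕜} (ρI : I →* 𝕜) (hρI : ∀ h : I, ρ (h : G) = ρI h)
    (hne : ρI ≠ θ) : ∑ h : I, θ h⁻¹ * ρ h = 0 := by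
  have hne' : twist θ ρI ≠ 1 := by
    rw [Ne, twist_eq_one_iff]
    exact hne
  have := sum_hom_units_eq_zero (twist θ ρI) hne'
  simpa [hρI] using this

/-- SEPARATION by a family of test functions, in the tree's mass currency (k3-g29's `CharactersSeparate`
is the case `𝔛 = {χ.toFun | χ : LevelChar 𝒰 𝕜}`). -/
def SeparatesD (𝒰 : SubgroupTower G) (𝕜 : Type*) [NormedField 𝕜] (𝔛 : Set (G → 𝕜)) : Prop :=
  ∀ D₁ D₂ : GroupDistribution 𝒰 𝕜,
    (∀ χ ∈ 𝔛, D₁.integral χ = D₂.integral χ) → ∀ n a, D₁.μ n a = D₂.μ n a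

/-- A family of TYPED multiplicative test functions: tower-continuous, multiplicative, with an inertia type. -/
structure TypedFamily (𝒰 : SubgroupTower G) (I : Subgroup G) (𝔛 : Set (G → 𝕜)) : Prop where
  cont : ∀ χ ∈ 𝔛, 𝒰.IsTowerContinuous χ
  mul : ∀ χ ∈ 𝔛, ∀ σ τ, χ (σ * τ) = χ σ * χ τ
  typed : ∀ χ ∈ 𝔛, ∃ χI : I →* 𝕜, ∀ h : I, χ (h : G) = χI h

/-- **THE CUT, tree currency, integral form**: coset tables ⟹ `E_θ ∗ X = E_θ ∗ Y` as MASSES. -/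
theorem conv_cosetDist_masses_eq_of_cosetTables [IsUltrametricDist 𝕜] [CompleteSpace 𝕜]
    {𝔛 : Set (G → 𝕜)} (h𝔛 : TypedFamily 𝒰 I 𝔛) (hsep : SeparatesD 𝒰 𝕜 𝔛) (θ : I →* 𝕜)
    (X Y : GroupDistribution 𝒰 𝕜)
    (htab : ∀ χ ∈ 𝔛, (∀ h : I, χ (h : G) = θ h) → X.integral χ = Y.integral χ) :
    ∀ n a, (conv (cosetDist 𝒰 I θ) X).μ n a = (conv (cosetDist 𝒰 I θ) Y).μ n a := by
  apply hsep
  intro χ hχ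
  rw [integral_conv_cosetDist θ X (h𝔛.cont χ hχ) (h𝔛.mul χ hχ),
    integral_conv_cosetDist θ Y (h𝔛.cont χ hχ) (h𝔛.mul χ hχ)]
  obtain ⟨χI, hχI⟩ := h𝔛.typed χ hχ
  by_cases ht : χI = θ
  · have hty : ∀ h : I, χ (h : G) = θ h := fun h => by rw [hχI, ht]
    rw [htab χ hχ hty]
  · rw [typeSum_of_ne θ χI hχI ht, zero_mul, zero_mul]

/-- **THE CUT, tree currency, value form**: coset tables ⟹ `∫ρ dX = ∫ρ dY` for EVERY tower-continuous
multiplicative `ρ` of type `θ` (in the family or not — e.g. `ρ_v` of infinite order). -/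
theorem integral_eq_of_cosetTables [IsUltrametricDist 𝕜] [CompleteSpace 𝕜] {𝔛 : Set (G → 𝕜)}
    (h𝔛 : TypedFamily 𝒰 I 𝔛) (hsep : SeparatesD 𝒰 𝕜 𝔛) (θ : I →* 𝕜) (hI : (Fintype.card I : 𝕜) ≠ 0)
    (X Y : GroupDistribution 𝒰 𝕜)
    (htab : ∀ χ ∈ 𝔛, (∀ h : I, χ (h : G) = θ h) → X.integral χ = Y.integral χ)
    {ρ : G → 𝕜} (hρc : 𝒰.IsTowerContinuous ρ) (hρ : ∀ σ τ, ρ (σ * τ) = ρ σ * ρ τ)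
    (hρθ : ∀ h : I, ρ (h : G) = θ h) : X.integral ρ = Y.integral ρ := by
  have hm := conv_cosetDist_masses_eq_of_cosetTables h𝔛 hsep θ X Y htab
  have h := integral_congr_masses _ _ hm ρ
  rw [integral_conv_cosetDist θ X hρc hρ, integral_conv_cosetDist θ Y hρc hρ, typeSum_of_eq θ hρθ] at h
  exact mul_left_cancel₀ hI h

/-- **Row 84's `value_of_tables_normalised` with the table hypothesis CUT TO THE COSET.**  Tables of the
normalised identity `∫χ d𝒜 · ∫χ dkatz = ∫χ dC · ∫χ dcol` at the type-`θ` members of a separating typed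
family, plus `∫ρ d𝒜 = 1`, give `∫ρ dkatz = ∫ρ dC · ∫ρ dcol` at every `ρ` of type `θ` — `c(key) = ∫ρ_v dC_v`. -/
theorem value_of_cosetTables_normalised [IsUltrametricDist 𝕜] [CompleteSpace 𝕜] {𝔛 : Set (G → 𝕜)}
    (h𝔛 : TypedFamily 𝒰 I 𝔛) (hsep : SeparatesD 𝒰 𝕜 𝔛) (θ : I →* 𝕜) (hI : (Fintype.card I : 𝕜) ≠ 0)
    (A katz C col : GroupDistribution 𝒰 𝕜)
    (htab : ∀ χ ∈ 𝔛, (∀ h : I, χ (h : G) = θ h) →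
      A.integral χ * katz.integral χ = C.integral χ * col.integral χ)
    {ρ : G → 𝕜} (hρc : 𝒰.IsTowerContinuous ρ) (hρ : ∀ σ τ, ρ (σ * τ) = ρ σ * ρ τ)
    (hρθ : ∀ h : I, ρ (h : G) = θ h) (hA : A.integral ρ = 1) :
    katz.integral ρ = C.integral ρ * col.integral ρ := by
  have h := integral_eq_of_cosetTables h𝔛 hsep θ hI (conv A katz) (conv C col) (fun χ hχ hty => by
    rw [integral_conv_of_mul A katz (h𝔛.cont χ hχ) (h𝔛.mul χ hχ),
      integral_conv_of_mul C col (h𝔛.cont χ hχ) (h𝔛.mul χ hχ), htab χ hχ hty]) hρc hρ hρθ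
  rwa [integral_conv_of_mul A katz hρc hρ, integral_conv_of_mul C col hρc hρ, hA, one_mul] at h

/-- **LOSSLESS, tree currency**: the mass identity `E_θ ∗ X = E_θ ∗ Y` gives back every coset table entry. -/
theorem cosetTable_of_conv_cosetDist_masses_eq [IsUltrametricDist 𝕜] [CompleteSpace 𝕜] (θ : I →* 𝕜)
    (hI : (Fintype.card I : 𝕜) ≠ 0) (X Y : GroupDistribution 𝒰 𝕜)
    (hm : ∀ n a, (conv (cosetDist 𝒰 I θ) X).μ n a = (conv (cosetDist 𝒰 I θ) Y).μ n a)
    {χ : G → 𝕜} (hχc : 𝒰.IsTowerContinuous χ) (hχ : ∀ σ τ, χ (σ * τ) = χ σ * χ τ)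
    (hχθ : ∀ h : I, χ (h : G) = θ h) : X.integral χ = Y.integral χ := by
  have h := integral_congr_masses _ _ hm χ
  rw [integral_conv_cosetDist θ X hχc hχ, integral_conv_cosetDist θ Y hχc hχ, typeSum_of_eq θ hχθ] at h
  exact mul_left_cancel₀ hI h

end TreeCurrency

end Summit.BirchSwinnertonDyer.BirchSwinnertonDyer.Cruxes.SplitBadTwoLowerHalfOfFacts.CosetCutK1G35
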